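import Summits.QuantumFields.YangMills.Theorems.DiagonalMirrorRPRWilsonDiagonalModelSchurCut
import Summits.QuantumFields.YangMills.Theorems.DiagonalMirrorRPRWilsonDiagonalModelFeatureLift

/-!
# Crux `DiagonalMirrorRPR` (stmt-QuantumFields-10604), line `sign-twisted-diagonal-trace`, construction F1_diag
# (director-ym O4 WORD 3 (A)), operator layer, step S2: the LIFTED KERNEL `𝔞 = Φ Ô Φ†` of the diagonal step and its SYMMETRY

Helper for the crux `DiagonalMirrorRPR` of `YangMills` (routes `IsotropyFromPowerCounting`, `MirrorModularBoosts`,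
`PencilRigidity`; item stmt-QuantumFields-10604), attached `--supports … --as helper`; it closes nothing by itself.
Continuation of `…WilsonDiagonalModelSchurCut` (feature form of the Θ-twisted even half step) and `…FeatureLift`
(`exp(β⟨w,w′⟩) = Σ_q φ_q(w) φ_q(w′)`), ROADMAP-F1diag v2 §1½.

* `bondVec ρ Y : Fin p → ℝ` (the bond features as a vector), `evenActionU_thetaHalf_eq_sum_bondVec`, and
  ★ **`hasSum_expFeature_even`**: `exp(β · even(Y, X, Y′)) = exp(β · inslab X) · Σ_q φ_q(w(ΘY′)) φ_q(w(Y))` — the even half step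
  IS `Φ† Φ` at kernel level (`β ≥ 0`, unitary `ρ`).
* `LiftIdx S Nc = ExpIdx p` and ★ **`liftedKernel ρ β`** on `LiftIdx × (in-slab half layer)`:
  `𝔞((q,X),(q′,X′)) = e^{β inslab(X)/2} e^{β inslab(X′)/2} ∫ φ_q(w(ΘY)) exp(β · odd(X, Y, X′)) φ_{q′}(w(Y)) dY` — the kernel of
  `Φ Ô Φ†`, the SELF-ADJOINT realisation of the two-step operator `K_u = Ê Ô`.
* `thetaEquiv`, `measurePreserving_thetaEquiv` (`Θ` preserves the half-layer Haar measure) and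
  ★ **`liftedKernel_symm`**: `𝔞(a, b) = 𝔞(b, a)` (from `oddActionU_reverse`).
* `continuous_bondVec`, `continuous_expFeature_bondVec`, `integrable_of_continuous_halfHaar`, `exists_exp_oddActionU_le`,
  `exists_exp_inslabAction_le`, and **`exists_abs_liftedKernel_le`**: `|𝔞((q,X),(q′,X′))| ≤ C ∫ |φ_q(w(ΘY))| |φ_{q′}(w(Y))| dY`
  with `C` uniform — the first step of `𝔞 ∈ L²(counting ⊗ halfHaar)²` (then Jensen and `Σ_q φ_q(w)² = exp(β|w|²) ≤ exp(β p)`,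
  `tsum_expFeature_sq_le`; OWED), after which the tree's `L²`-kernel Hilbert–Schmidt package
  (`Literature/Analysis/OperatorTheory/L2Kernel{IntegralOperator,HilbertSchmidt,Pairing}`, `CompactSelfAdjointEigenbasis`)
  yields the operator, its eigen-data, `Σ λ² = ‖𝔞‖²`, and the trace formulas `Σ λ^m = diagCyclicTraceU ρ β m`.

HONEST FRAMING: a construction helper; no operator is built here yet, no `def wilsonDiagonalModel`; nothing about D_old
⟨10604⟩, the RP crux of the FOLD restate, or the summit is proved; the Yang–Mills mass gap is NOT proved here or anywhere in
the tree.

References: M. Reed, B. Simon, *Methods of Modern Mathematical Physics I* (1980) Thm VI.22–23; K. Osterwalder, E. Seiler,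
Ann. Phys. 110 (1978) §2–3.
-/

set_option autoImplicit false

noncomputable section

open MeasureTheory
open Literature.MathematicalPhysics.QuantumLattice Literature.MathematicalPhysics.QuantumFieldTheory
open Summit.QuantumFields.YangMills.Cruxes.DiagonalMirrorRPR.ParityBridgeColdTraces

namespace Summit.QuantumFields.YangMills.Cruxes.DiagonalMirrorRPR.SignTwistedDiagonalTrace.WilsonDiagonal

/-! ## §14 The lifted kernel `𝔞 = Φ Ô Φ†` of the diagonal step on (feature index) × (in-slab half layer) -/

section LiftedKernel

variable {S : ℕ} [NeZero S] {G : Type*} [Group G] {Nc : ℕ} (ρ : G →* Matrix (Fin Nc) (Fin Nc) ℂ)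

/-- The number of real features of a bond half layer. -/
abbrev featDim (S Nc : ℕ) [NeZero S] : ℕ := Fintype.card (FeatIdx S Nc)

/-- The feature VECTOR `w(Y) ∈ ℝᵖ` of a bond half layer (`bondFeature` re-indexed by `Fin p`). -/
def bondVec (Y : HalfCfg S S G) : Fin (featDim S Nc) → ℝ :=
  fun j => bondFeature ρ Y ((Fintype.equivFin (FeatIdx S Nc)).symm j)

/-- `even(Y, X, ΘY″) = ⟨w(Y″), w(Y)⟩ + inslab(X)` with the feature VECTORS (unitary `ρ`). -/
theorem evenActionU_thetaHalf_eq_sum_bondVec (hρu : ∀ g, ρ g ∈ Matrix.unitaryGroup (Fin Nc) ℂ)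
    (Y X Y'' : HalfCfg S S G) :
    evenActionU ρ Y X (thetaHalf Y'') = (∑ j, bondVec ρ Y'' j * bondVec ρ Y j) + inslabAction ρ X := by
  rw [evenActionU_thetaHalf_eq_sum_feature ρ hρu, ← (Fintype.equivFin (FeatIdx S Nc)).symm.sum_comp]
  rfl

/-- ★ **The even half step through the feature lift**: for `β ≥ 0` and unitary `ρ`,
`exp(β · even(Y, X, Y′)) = exp(β · inslab X) · Σ_q φ_q(w(ΘY′)) φ_q(w(Y))` — `Ê = Φ† Φ` at kernel level. -/
theorem hasSum_expFeature_even {β : ℝ} (hβ : 0 ≤ β) (hρu : ∀ g, ρ g ∈ Matrix.unitaryGroup (Fin Nc) ℂ)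
    (Y X Y' : HalfCfg S S G) :
    HasSum (fun q : ExpIdx (featDim S Nc) =>
        Real.exp (β * inslabAction ρ X) * (expFeature β q (bondVec ρ (thetaHalf Y')) * expFeature β q (bondVec ρ Y)))
      (Real.exp (β * evenActionU ρ Y X Y')) := by
  have h := (hasSum_expFeature_mul_expFeature hβ (bondVec ρ (thetaHalf Y')) (bondVec ρ Y)).mul_left
    (Real.exp (β * inslabAction ρ X))
  have hev : evenActionU ρ Y X Y' = (∑ j, bondVec ρ (thetaHalf Y') j * bondVec ρ Y j) + inslabAction ρ X := by
    rw [← evenActionU_thetaHalf_eq_sum_bondVec ρ hρu Y X (thetaHalf Y'), thetaHalf_thetaHalf]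
  rw [hev, mul_add, Real.exp_add, mul_comm (Real.exp _) (Real.exp (β * inslabAction ρ X))]
  exact h

/-- The lifted index: an exponential feature index of the bond features. -/
abbrev LiftIdx (S Nc : ℕ) [NeZero S] : Type := ExpIdx (featDim S Nc)

variable [TopologicalSpace G] [IsTopologicalGroup G] [CompactSpace G] [MeasurableSpace G] [BorelSpace G]

/-- **The lifted kernel of the diagonal step** on `LiftIdx × (in-slab half layer)`:
`𝔞((q, X), (q′, X′)) = e^{β inslab(X)/2} e^{β inslab(X′)/2} ∫ φ_q(w(ΘY)) · exp(β · odd(X, Y, X′)) · φ_{q′}(w(Y)) dY` —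
the kernel of `Φ Ô Φ†`, the SELF-ADJOINT realisation of the two-step operator `K_u = Ê Ô` (same non-zero spectrum); its
cyclic `m`-fold trace over `(counting ⊗ halfHaar)` resums (feature lift, `hasSum_expFeature_even`) to the cyclic `K_u`-chain
`diagCyclicTraceU ρ β m` (OWED: `…TraceFormula`). -/
def liftedKernel (β : ℝ) (a b : LiftIdx S Nc × HalfCfg S S G) : ℝ :=
  Real.exp (β / 2 * inslabAction ρ a.2) * Real.exp (β / 2 * inslabAction ρ b.2) *
    ∫ Y, expFeature β a.1 (bondVec ρ (thetaHalf Y)) * Real.exp (β * oddActionU ρ a.2 Y b.2) *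
      expFeature β b.1 (bondVec ρ Y) ∂(halfHaar S G)

/-- The label involution `Θ` as a measurable equivalence of half layers (a relabelling of the product). -/
def thetaEquiv : HalfCfg S S G ≃ᵐ HalfCfg S S G :=
  MeasurableEquiv.piCongrLeft (fun _ : SlabSite S S × Fin 2 => G)
    ((Equiv.refl (SlabSite S S)).prodCongr (Equiv.swap (0 : Fin 2) 1))

omit [NeZero S] [Group G] [TopologicalSpace G] [IsTopologicalGroup G] [CompactSpace G] [BorelSpace G] in
/-- `thetaEquiv` is `thetaHalf`. -/
theorem thetaEquiv_apply (Y : HalfCfg S S G) : thetaEquiv Y = thetaHalf Y := by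
  funext p
  simp only [thetaEquiv, MeasurableEquiv.coe_piCongrLeft, Equiv.piCongrLeft_apply_eq_cast, cast_eq, thetaHalf,
    Equiv.prodCongr_symm, Equiv.symm_swap, Equiv.prodCongr_apply]
  rfl

/-- `Θ` preserves the half-layer Haar measure. -/
theorem measurePreserving_thetaEquiv :
    MeasurePreserving (thetaEquiv : HalfCfg S S G ≃ᵐ HalfCfg S S G) (halfHaar S G) (halfHaar S G) := by
  unfold thetaEquiv halfHaar
  exact measurePreserving_piCongrLeft (μ := fun _ : SlabSite S S × Fin 2 => haarProbability G) _

/-- ★ **The lifted kernel is SYMMETRIC** (`Θ` is a measure-preserving involution and the odd half step is Θ-pseudo-symmetric,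
`oddActionU_reverse`): `𝔞(a, b) = 𝔞(b, a)`. -/
theorem liftedKernel_symm (β : ℝ) (a b : LiftIdx S Nc × HalfCfg S S G) :
    liftedKernel ρ β a b = liftedKernel ρ β b a := by
  unfold liftedKernel
  rw [mul_comm (Real.exp (β / 2 * inslabAction ρ a.2)) (Real.exp (β / 2 * inslabAction ρ b.2))]
  congr 1
  conv_rhs => rw [← (measurePreserving_thetaEquiv (S := S) (G := G)).integral_comp']
  refine integral_congr_ae (ae_of_all _ fun Y => ?_)
  simp only [thetaEquiv_apply, thetaHalf_thetaHalf, oddActionU_reverse]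
  ring

/-- The lifted kernel with its exponential prefactors split evenly reproduces, along a cycle, the full in-slab weights:
`𝔞` is `e^{β inslab/2} ⊗ e^{β inslab/2}`-conjugate to the bare kernel `∫ φ_q(w(ΘY)) e^{β odd} φ_{q′}(w(Y)) dY`. -/
theorem liftedKernel_eq (β : ℝ) (a b : LiftIdx S Nc × HalfCfg S S G) :
    liftedKernel ρ β a b = Real.exp (β / 2 * inslabAction ρ a.2) * Real.exp (β / 2 * inslabAction ρ b.2) *
      ∫ Y, expFeature β a.1 (bondVec ρ (thetaHalf Y)) * Real.exp (β * oddActionU ρ a.2 Y b.2) *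
        expFeature β b.1 (bondVec ρ Y) ∂(halfHaar S G) := rfl

/-! ### Continuity and integrability bookkeeping on half layers -/

omit [NeZero S] [Group G] [IsTopologicalGroup G] [CompactSpace G] [MeasurableSpace G] [BorelSpace G] in
/-- `Θ` is continuous (a relabelling). -/
theorem continuous_thetaHalf : Continuous (thetaHalf : HalfCfg S S G → HalfCfg S S G) :=
  continuous_pi fun _ => continuous_apply _

omit [CompactSpace G] [MeasurableSpace G] [BorelSpace G] in
/-- The feature vector depends continuously on the bond half layer (continuous `ρ`). -/
theorem continuous_bondVec (hρ : Continuous ρ) : Continuous fun Y : HalfCfg S S G => bondVec ρ Y := by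
  refine continuous_pi fun j => ?_
  unfold bondVec bondFeature diamond
  have hc : Continuous fun Y : HalfCfg S S G =>
      ρ (Y (((Fintype.equivFin (FeatIdx S Nc)).symm j).1, 1) *
        Y (((Fintype.equivFin (FeatIdx S Nc)).symm j).1 + slabStep 1, 0))
        ((Fintype.equivFin (FeatIdx S Nc)).symm j).2.1 ((Fintype.equivFin (FeatIdx S Nc)).symm j).2.2.1 :=
    Continuous.matrix_elem (hρ.comp (by fun_prop)) _ _
  split_ifs
  · exact Complex.continuous_re.comp hc
  · exact Complex.continuous_im.comp hc

omit [CompactSpace G] [MeasurableSpace G] [BorelSpace G] in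
/-- Each lifted feature `Y ↦ φ_q(w(Y))` is continuous. -/
theorem continuous_expFeature_bondVec (hρ : Continuous ρ) (β : ℝ) (q : LiftIdx S Nc) :
    Continuous fun Y : HalfCfg S S G => expFeature β q (bondVec ρ Y) :=
  (continuous_expFeature β q).comp (continuous_bondVec ρ hρ)

/-- A continuous real function on a half layer is integrable for the half-layer Haar measure (compactness). -/
theorem integrable_of_continuous_halfHaar [SecondCountableTopology G] {f : HalfCfg S S G → ℝ} (hf : Continuous f) :
    Integrable f (halfHaar S G) := by
  haveI : IsFiniteMeasure (halfHaar S G) := by unfold halfHaar; infer_instance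
  obtain ⟨C, hC⟩ := (isCompact_univ.image (continuous_norm.comp hf)).isBounded.bddAbove
  exact Integrable.of_bound hf.measurable.aestronglyMeasurable C
    (ae_of_all _ fun Y => hC ⟨Y, Set.mem_univ _, rfl⟩)

/-! ### Uniform bounds (towards `𝔞 ∈ L²`: `|𝔞((q,X),(q′,X′))| ≤ C ∫ |φ_q(w(ΘY))| |φ_{q′}(w(Y))| dY`) -/

omit [MeasurableSpace G] [BorelSpace G] in
/-- The odd half-step weight is uniformly bounded (continuity on a compact group). -/
theorem exists_exp_oddActionU_le (hρ : Continuous ρ) (β : ℝ) :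
    ∃ C : ℝ, 0 < C ∧ ∀ X Y X' : HalfCfg S S G, Real.exp (β * oddActionU ρ X Y X') ≤ C := by
  have hc : Continuous fun t : HalfCfg S S G × HalfCfg S S G × HalfCfg S S G =>
      Real.exp (β * oddActionU ρ t.1 t.2.1 t.2.2) := by
    refine Real.continuous_exp.comp (continuous_const.mul ?_)
    unfold oddActionU
    refine continuous_finsetSum _ fun s _ => ?_
    have h : ∀ f : HalfCfg S S G × HalfCfg S S G × HalfCfg S S G → G, Continuous f →
        Continuous fun t => (ρ (f t)).trace.re := fun f hf =>
      Complex.continuous_re.comp (Continuous.matrix_trace (hρ.comp hf))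
    exact (((h _ (by fun_prop)).add (h _ (by fun_prop))).add (h _ (by fun_prop))).add (h _ (by fun_prop))
  obtain ⟨C, hC⟩ := (isCompact_univ.image hc).isBounded.bddAbove
  refine ⟨max C 1, lt_max_of_lt_right one_pos, fun X Y X' => le_trans ?_ (le_max_left _ _)⟩
  exact hC ⟨(X, Y, X'), Set.mem_univ _, rfl⟩

omit [MeasurableSpace G] [BorelSpace G] in
/-- The half in-slab weight is uniformly bounded. -/
theorem exists_exp_inslabAction_le (hρ : Continuous ρ) (β : ℝ) :
    ∃ C : ℝ, 0 < C ∧ ∀ X : HalfCfg S S G, Real.exp (β / 2 * inslabAction ρ X) ≤ C := by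
  have hc : Continuous fun X : HalfCfg S S G => Real.exp (β / 2 * inslabAction ρ X) := by
    refine Real.continuous_exp.comp (continuous_const.mul ?_)
    unfold inslabAction
    refine continuous_finsetSum _ fun s _ => Complex.continuous_re.comp (Continuous.matrix_trace (hρ.comp ?_))
    fun_prop
  obtain ⟨C, hC⟩ := (isCompact_univ.image hc).isBounded.bddAbove
  exact ⟨max C 1, lt_max_of_lt_right one_pos, fun X => le_trans (hC ⟨X, Set.mem_univ _, rfl⟩) (le_max_left _ _)⟩

/-- **Pointwise domination of the lifted kernel** by the product of feature moduli:
`|𝔞((q,X),(q′,X′))| ≤ C · ∫ |φ_q(w(ΘY))| · |φ_{q′}(w(Y))| dY` with `C` independent of `q, q′, X, X′` — the first step of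
`𝔞 ∈ L²(counting ⊗ halfHaar)` (then Jensen and `Σ_q φ_q² = exp(β|w|²) ≤ exp(β p)`, OWED). -/
theorem exists_abs_liftedKernel_le [SecondCountableTopology G] (hρ : Continuous ρ) (β : ℝ) :
    ∃ C : ℝ, 0 < C ∧ ∀ a b : LiftIdx S Nc × HalfCfg S S G,
      |liftedKernel ρ β a b| ≤ C * ∫ Y, |expFeature β a.1 (bondVec ρ (thetaHalf Y))| * |expFeature β b.1 (bondVec ρ Y)|
        ∂(halfHaar S G) := by
  obtain ⟨Co, hCo, hodd⟩ := exists_exp_oddActionU_le (S := S) ρ hρ β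
  obtain ⟨Ci, hCi, hins⟩ := exists_exp_inslabAction_le (S := S) ρ hρ β
  refine ⟨Ci * Ci * Co, by positivity, fun a b => ?_⟩
  rw [liftedKernel, abs_mul, abs_mul, abs_of_pos (Real.exp_pos _), abs_of_pos (Real.exp_pos _)]
  have hint : |∫ Y, expFeature β a.1 (bondVec ρ (thetaHalf Y)) * Real.exp (β * oddActionU ρ a.2 Y b.2) *
      expFeature β b.1 (bondVec ρ Y) ∂(halfHaar S G)| ≤
      Co * ∫ Y, |expFeature β a.1 (bondVec ρ (thetaHalf Y))| * |expFeature β b.1 (bondVec ρ Y)| ∂(halfHaar S G) := by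
    rw [← integral_const_mul]
    refine (abs_integral_le_integral_abs).trans (integral_mono_of_nonneg (ae_of_all _ fun Y => abs_nonneg _) ?_
      (ae_of_all _ fun Y => ?_))
    · -- integrability of the dominating function: continuous on a compact probability space
      exact (integrable_of_continuous_halfHaar
        ((((continuous_expFeature_bondVec ρ hρ β a.1).comp continuous_thetaHalf).abs).mul
          (continuous_expFeature_bondVec ρ hρ β b.1).abs)).const_mul Co
    · dsimp only
      rw [abs_mul, abs_mul, abs_of_pos (Real.exp_pos _)]
      calc |expFeature β a.1 (bondVec ρ (thetaHalf Y))| * Real.exp (β * oddActionU ρ a.2 Y b.2) *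
            |expFeature β b.1 (bondVec ρ Y)|
          ≤ |expFeature β a.1 (bondVec ρ (thetaHalf Y))| * Co * |expFeature β b.1 (bondVec ρ Y)| :=
            mul_le_mul_of_nonneg_right (mul_le_mul_of_nonneg_left (hodd _ _ _) (abs_nonneg _)) (abs_nonneg _)
        _ = Co * (|expFeature β a.1 (bondVec ρ (thetaHalf Y))| * |expFeature β b.1 (bondVec ρ Y)|) := by ring
  have hI0 : 0 ≤ ∫ Y, |expFeature β a.1 (bondVec ρ (thetaHalf Y))| * |expFeature β b.1 (bondVec ρ Y)| ∂(halfHaar S G) :=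
    integral_nonneg fun Y => mul_nonneg (abs_nonneg _) (abs_nonneg _)
  calc Real.exp (β / 2 * inslabAction ρ a.2) * Real.exp (β / 2 * inslabAction ρ b.2) *
        |∫ Y, expFeature β a.1 (bondVec ρ (thetaHalf Y)) * Real.exp (β * oddActionU ρ a.2 Y b.2) *
          expFeature β b.1 (bondVec ρ Y) ∂(halfHaar S G)|
      ≤ Ci * Ci * (Co * ∫ Y, |expFeature β a.1 (bondVec ρ (thetaHalf Y))| * |expFeature β b.1 (bondVec ρ Y)|
          ∂(halfHaar S G)) :=
        mul_le_mul (mul_le_mul (hins _) (hins _) (Real.exp_pos _).le hCi.le) hint (abs_nonneg _) (by positivity)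
    _ = Ci * Ci * Co * ∫ Y, |expFeature β a.1 (bondVec ρ (thetaHalf Y))| * |expFeature β b.1 (bondVec ρ Y)|
          ∂(halfHaar S G) := by ring

end LiftedKernel

end Summit.QuantumFields.YangMills.Cruxes.DiagonalMirrorRPR.SignTwistedDiagonalTrace.WilsonDiagonal

end
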